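import Summits.BirchSwinnertonDyer.BirchSwinnertonDyer.Theses.PrintCf2RubinValueTwo
import Summits.BirchSwinnertonDyer.BirchSwinnertonDyer.Theorems.BiquadraticEisensteinDescentDeuringWithGeneratorsHolds
import HarnessLib

set_option linter.dupNamespace false -- `Summit.BirchSwinnertonDyer.BirchSwinnertonDyer.Theorems.…` (summit = sub)
set_option autoImplicit false

/-!
# Route `PrintCf2RubinValueTwo`, aside item `DeuringGrossencharacterWithGenerators` (stmt-BirchSwinnertonDyer-23770): CLOSED

The aside is the named Literature fact `Deuring_exists_heckeCharacter_of_maximalCM_withGenerators` BY NAME («closes only by formalising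
the source: `theorem … : PrintCf2RubinValueTwo.<Decl> := <fact>_holds` once a `_holds` exists», route text). The `_holds` exists:
`Summit.BirchSwinnertonDyer.BirchSwinnertonDyer.Theorems.BiquadraticEisensteinDescentDeuringOfCore.Deuring_exists_heckeCharacter_of_maximalCM_withGenerators_holds`
(cell `bsd-wall`, BED «Deuring-ψ lane», seats w1/w3/w4 g12–g18). HONEST STATUS: an INPUT of road α is now a theorem; nothing about
`RubinValueFormulaAtTwo` / the PrintCf2 cruxes or any case of BSD is asserted.
-/

noncomputable section

namespace Summit.BirchSwinnertonDyer.BirchSwinnertonDyer.Theorems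

/-- **Item 23770 `DeuringGrossencharacterWithGenerators` holds** (Deuring's theorem with generator values, Silverman ATAEC II Thm. 9.1 (i),
Thm. 9.2, Prop. 10.4, Cor. 10.4.1 (a), Thm. 10.5 (b)) — by the kernel theorem of the BED Deuring-ψ lane.
[cite: SilvermanATAEC1994, Ch. II Thm. 9.1 (i), Thm. 9.2, Prop. 10.4, Cor. 10.4.1 (a), Thm. 10.5 (b)] -/
theorem deuringGrossencharacterWithGenerators_proof :
    Summit.BirchSwinnertonDyer.BirchSwinnertonDyer.Theses.PrintCf2RubinValueTwo.DeuringGrossencharacterWithGenerators := by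
  unfold Summit.BirchSwinnertonDyer.BirchSwinnertonDyer.Theses.PrintCf2RubinValueTwo.DeuringGrossencharacterWithGenerators
  exact BiquadraticEisensteinDescentDeuringOfCore.Deuring_exists_heckeCharacter_of_maximalCM_withGenerators_holds

end Summit.BirchSwinnertonDyer.BirchSwinnertonDyer.Theorems

end
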